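import Summits.Ventures.GridStability.Models.SwingFrequencyBound
import Summits.Ventures.GridStability.Models.WSCC9

/-!
# GridStability/Models/WSCC9FrequencyBand — rider «#79′ WSCC9-BAND»: the global speed-band numerals of «WSCC9-postB-SPdamp», exact

Cell `gridfusion` (LADDER-GRIDFUSION; seat gridfusion-model-3 (g7); lead RULING 5w (c)). Instance reading
of `Models/SwingFrequencyBound.lean` (#79-cand «G3.e-SWING-FREQ-BAND-THM», `ClassicalSwing.abs_speed_le`)
on the classical object of record `WSCC9.postB_SPdamp.toModel` (post-fault «post-B» h12 reduction,
A1 effective powers `P′ = Pprime`, damping `D_i/M_i = 1/10, 1/5, 3/10` AS PRINTED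
[cite: SauerPai1998, Example 7.1]; data custody model-4, `Models/WSCC9.lean`).

§1 a kernel-friendly `ℚ` mirror `RecastData.imbalanceBoundQ` of `ClassicalSwing.imbalanceBound` for any
`RecastData` (List sum; bridge `imbalanceBound_toModel`). §2 the numerals, by `decide +kernel`:
`K_i/D_i = 98428839796524410280212284889177/411276428734946547480000000000 ≈ 239.33`,
`119534096170381775128532152228089/222687744831104729600000000000 ≈ 536.78`,
`11247688511109432538575574253891/15709924498631841471000000000 ≈ 715.96` [rad/s], rates `D_i/M_i =
1/10, 1/5, 3/10` [s⁻¹]; hence (`postB_SPdamp_abs_speed_le`) along EVERY solution on `[0, ∞)`: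
`|ω₁(t)| ≤ 240 + |ω₁(0)| e^{−t/10}`, `|ω₂(t)| ≤ 537 + |ω₂(0)| e^{−t/5}`, `|ω₃(t)| ≤ 716 + |ω₃(0)| e^{−3t/10}`.

THREE COLUMNS / HONEST MAGNITUDE. CERTIFIED: the inequalities. MODELLED: `M_cl` «WSCC9-postB-SPdamp»
(MV-2 + MV-P + MV-SPD + MV-ω + MV-h12), no governor, no limiter. The bands (hundreds of rad/s, i.e. tens
of Hz) are PHYSICALLY VACUOUS for these lightly damped machines (`D_i ≈ 0.005–0.013`): the rider is the
numeral of record showing how the certified band scales like `K_i/D_i` — meaningful for droop units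
(`D_i = 1/λ^p_i` large, `DroopMicrogrid.abs_freq_le`), vacuous here. Nothing about synchronism or
stability; VALIDATED: nothing.
-/

noncomputable section

open Real Set Finset

namespace Summit.Ventures.GridStability.Models

namespace RecastData

variable {n : ℕ} (d : RecastData n)

/-- Kernel-friendly `ℚ` mirror of `ClassicalSwing.imbalanceBound` for `d.toModel` (List sum over
`j ≠ i`): `|P′_i − E_i²G_ii| + Σ_{j≠i} (|C_ij| + |D_ij|)`. -/
def imbalanceBoundQ (i : Fin (n + 1)) : ℚ :=
  |d.Pprime i - d.E i ^ 2 * d.G i i|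
    + (((List.finRange (n + 1)).filter (· ≠ i)).map (fun j => |d.Cc i j| + |d.Dc i j|)).sum

/-- `imbalanceBoundQ` as a `Finset` sum. -/
theorem imbalanceBoundQ_eq (i : Fin (n + 1)) :
    d.imbalanceBoundQ i = |d.Pprime i - d.E i ^ 2 * d.G i i| + ∑ j ∈ univ.erase i, (|d.Cc i j| + |d.Dc i j|) := by
  unfold imbalanceBoundQ; congr 1
  rw [← List.sum_toFinset _ ((List.nodup_finRange _).filter _)]
  congr 1; ext j; simp [Finset.mem_erase, ne_comm]

/-- Bridge: the real bound of the model instance is the cast of the `ℚ` mirror. -/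
theorem imbalanceBound_toModel (i : Fin (n + 1)) :
    d.toModel.imbalanceBound i = (d.imbalanceBoundQ i : ℝ) := by
  rw [imbalanceBoundQ_eq]
  simp only [ClassicalSwing.imbalanceBound, toModel, ClassicalSwing.Ccoef, ClassicalSwing.Dcoef, Cc, Dc]
  push_cast
  rfl

end RecastData

namespace WSCC9

/-- The exact bands `K_i/D_i` of «WSCC9-postB-SPdamp» [rad/s]. -/
def bandSP : Fin 3 → ℚ :=
  ![(98428839796524410280212284889177 : ℚ) / 411276428734946547480000000000,
    (119534096170381775128532152228089 : ℚ) / 222687744831104729600000000000,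
    (11247688511109432538575574253891 : ℚ) / 15709924498631841471000000000]

/-- `K_i/D_i = bandSP i` exactly, and the rounded-up integers `240, 537, 716`. -/
theorem postB_SPdamp_band :
    (∀ i : Fin 3, postB_SPdamp.imbalanceBoundQ i / postB_SPdamp.D i = bandSP i) ∧
      bandSP 0 ≤ 240 ∧ bandSP 1 ≤ 537 ∧ bandSP 2 ≤ 716 := by
  refine ⟨?_, ?_, ?_, ?_⟩ <;> decide +kernel

/-- **Rider «#79′ WSCC9-BAND».** Along EVERY solution of `WSCC9.postB_SPdamp.toModel` on `[0, ∞)`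
(any initial state, angles unrestricted): `|ω_i(t)| ≤ K_i/D_i + |ω_i(0)| e^{−(D_i/M_i) t}` with the exact
`K_i/D_i = bandSP i` and `D_i/M_i = 1/10, 1/5, 3/10` AS PRINTED [cite: SauerPai1998, Example 7.1]; in
rounded form `|ω₁(t)| ≤ 240 + |ω₁(0)| e^{−t/10}`, `|ω₂(t)| ≤ 537 + |ω₂(0)| e^{−t/5}`,
`|ω₃(t)| ≤ 716 + |ω₃(0)| e^{−3t/10}` [rad/s]. MODELLED «WSCC9-postB-SPdamp»; physically vacuous
magnitudes (see module doc). -/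
theorem postB_SPdamp_abs_speed_le {γ : ℝ → ClassicalSwing.State 3}
    (h : postB_SPdamp.toModel.IsSolutionOn γ (Ici 0)) {t : ℝ} (ht : 0 ≤ t) :
    |(γ t).2 0| ≤ 240 + |(γ 0).2 0| * exp (-(1 / 10) * t) ∧
    |(γ t).2 1| ≤ 537 + |(γ 0).2 1| * exp (-(1 / 5) * t) ∧
    |(γ t).2 2| ≤ 716 + |(γ 0).2 2| * exp (-(3 / 10) * t) := by
  have hM : ∀ i : Fin 3, 0 < postB_SPdamp.toModel.M i := by
    intro i; show (0:ℝ) < ((postB_SPdamp.M i : ℚ) : ℝ)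
    fin_cases i <;> norm_num [postB_SPdamp, WSCC9.M]
  have hD : ∀ i : Fin 3, 0 < postB_SPdamp.toModel.D i := by
    intro i; show (0:ℝ) < ((postB_SPdamp.D i : ℚ) : ℝ)
    fin_cases i <;> norm_num [postB_SPdamp, WSCC9.D_SP]
  -- exact bands ≤ integers, cast to ℝ
  have hb : ∀ i : Fin 3, (postB_SPdamp.imbalanceBoundQ i : ℝ) / postB_SPdamp.toModel.D i
      = (bandSP i : ℝ) := by
    intro i
    have hq := postB_SPdamp_band.1 i
    show (postB_SPdamp.imbalanceBoundQ i : ℝ) / ((postB_SPdamp.D i : ℚ) : ℝ) = (bandSP i : ℝ)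
    rw [← hq]; push_cast; rfl
  have r0 : postB_SPdamp.toModel.D 0 / postB_SPdamp.toModel.M 0 = 1 / 10 := by
    show ((postB_SPdamp.D 0 : ℚ) : ℝ) / ((postB_SPdamp.M 0 : ℚ) : ℝ) = 1 / 10
    norm_num [postB_SPdamp, WSCC9.D_SP, WSCC9.M]
  have r1 : postB_SPdamp.toModel.D 1 / postB_SPdamp.toModel.M 1 = 1 / 5 := by
    show ((postB_SPdamp.D 1 : ℚ) : ℝ) / ((postB_SPdamp.M 1 : ℚ) : ℝ) = 1 / 5
    norm_num [postB_SPdamp, WSCC9.D_SP, WSCC9.M]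
  have r2 : postB_SPdamp.toModel.D 2 / postB_SPdamp.toModel.M 2 = 3 / 10 := by
    show ((postB_SPdamp.D 2 : ℚ) : ℝ) / ((postB_SPdamp.M 2 : ℚ) : ℝ) = 3 / 10
    have hD2 : postB_SPdamp.D 2 = 903 / 188500 := by decide +kernel
    have hM2 : postB_SPdamp.M 2 = 301 / 18850 := by decide +kernel
    rw [hD2, hM2]; norm_num
  have c0 : ((bandSP 0 : ℚ) : ℝ) ≤ 240 := by exact_mod_cast postB_SPdamp_band.2.1
  have c1 : ((bandSP 1 : ℚ) : ℝ) ≤ 537 := by exact_mod_cast postB_SPdamp_band.2.2.1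
  have c2 : ((bandSP 2 : ℚ) : ℝ) ≤ 716 := by exact_mod_cast postB_SPdamp_band.2.2.2
  have k0 := ClassicalSwing.abs_speed_le h (hM 0) (hD 0) ht
  have k1 := ClassicalSwing.abs_speed_le h (hM 1) (hD 1) ht
  have k2 := ClassicalSwing.abs_speed_le h (hM 2) (hD 2) ht
  rw [RecastData.imbalanceBound_toModel, hb, r0] at k0
  rw [RecastData.imbalanceBound_toModel, hb, r1] at k1
  rw [RecastData.imbalanceBound_toModel, hb, r2] at k2
  have e0 := (exp_pos (-(1 / 10 : ℝ) * t)).le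
  have e1 := (exp_pos (-(1 / 5 : ℝ) * t)).le
  have e2 := (exp_pos (-(3 / 10 : ℝ) * t)).le
  exact ⟨by linarith, by linarith, by linarith⟩

end WSCC9

end Summit.Ventures.GridStability.Models

end
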